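import Summits.ResolutionOfSingularities.ResolutionOfSingularities.Theorems.FrobeniusLadderFInjectiveMacaulayficationCensusBedsWeaklyNondegenerate
import HarnessLib

/-!
# (W-WND) the «good support» criterion for weak non-degeneracy, VERSION 2: monomials DOMINATED by another support point are exempt (they lie on no compact face)
# (crux `FInjectiveMacaulayfication` stmt-ResolutionOfSingularities-15315, chain w45a; seat res-L1-w45a-stub-3 g11; res-L1-w45a-plan-1 R21.15 (2) (D-2) «hWND on all 31 faces by a
# good-support/face-table lemma» for BED D's storey-2 germ `G = Y₃² + Y₁³ + Y₂³ + (1+Y₃)(Y₄Y₅⁴ + Y₄²Y₅)`, whose two non-vertex monomials `Y₃Y₄Y₅⁴`, `Y₃Y₄²Y₅` break the plain criterion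
# ✓ p656259 `weaklyNondegenerate_of_good_support` but never lie on a compact face)

[OURS · L1 W4.5a] Support file (`--supports stmt-ResolutionOfSingularities-15315 --as helper`); def-free; UNCONDITIONAL; no named fact. NOT a statement of any manuscript.
AI-written (AI review is weaker than expert review).

* `wdeg_lt_of_le_of_ne` — for a positive weight, a support point strictly dominates every componentwise-smaller one in weight; hence a DOMINATED exponent
  (`∃ γ ∈ supp f, γ ≤ β, γ ≠ β`) is never of minimal weight (`not_dominated_of_mem_face`);
* `not_tjurinaZero_face'`, ★ `weaklyNondegenerate_of_good_support'` — as ✓ p656259 with the hypothesis relaxed: every exponent `α ≠ β₀` is EITHER dominated OR good, where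
  «good» now also tolerates dominated competitors: `∃ i, (α i : k) ≠ 0 ∧ ∀ β ∈ supp f, β ≠ α → ((β i : k) = 0 ∨ β dominated)`.
[cite: BoubakriGreuelMarkwig2010, §3 (p. 10)]
-/

-- single-problem summit: the doubled namespace component is forced
set_option linter.dupNamespace false

noncomputable section

open MvPolynomial

namespace Summit.ResolutionOfSingularities.ResolutionOfSingularities.Theorems.FInjectiveMacaulayfication.CensusBedsWeaklyNondegenerate

open Summit.ResolutionOfSingularities.ResolutionOfSingularities.Theorems.FInjectiveMacaulayfication
open Literature.AlgebraicGeometry.Resolution Literature.AlgebraicGeometry.Resolution.BoubakriGreuelMarkwig NewtonChartLemma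

variable {k : Type} [Field k] {m : ℕ}

/-- For a positive weight `w`, `γ ≤ β`, `γ ≠ β` ⇒ `wdeg w γ < wdeg w β`. [folklore] -/
theorem wdeg_lt_of_le_of_ne (w : Fin m → ℝ) (hw : ∀ i, 0 < w i) (γ β : Fin m →₀ ℕ) (hle : γ ≤ β) (hne : γ ≠ β) :
    wdeg w γ < wdeg w β := by
  unfold wdeg pairing expPt
  have hex : ∃ j, γ j < β j := by
    by_contra hcon
    push Not at hcon
    exact hne (Finsupp.ext fun j => le_antisymm (hle j) (hcon j))
  obtain ⟨j, hj⟩ := hex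
  refine Finset.sum_lt_sum (fun i _ => ?_) ⟨j, Finset.mem_univ j, ?_⟩
  · exact mul_le_mul_of_nonneg_left (by exact_mod_cast hle i) (hw i).le
  · exact mul_lt_mul_of_pos_left (by exact_mod_cast hj) (hw j)

/-- A dominated exponent is not of minimal weight: it lies on no compact face. [folklore] -/
theorem not_dominated_of_mem_face (f : MvPolynomial (Fin m) k) (w : Fin m → ℝ) (hw : ∀ i, 0 < w i) (β : Fin m →₀ ℕ)
    (hβ : ∀ γ ∈ f.support, wdeg w β ≤ wdeg w γ) : ¬ ∃ γ ∈ f.support, γ ≤ β ∧ γ ≠ β := by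
  rintro ⟨γ, hγ, hle, hne⟩
  exact absurd (hβ γ hγ) (not_le.mpr (wdeg_lt_of_le_of_ne w hw γ β hle hne))

/-- **Core at one face, version 2** (dominated competitors allowed, dominated exponents exempt). [OURS · elementary; cite: BoubakriGreuelMarkwig2010, §3 (p. 10)] -/
theorem not_tjurinaZero_face' (f : MvPolynomial (Fin m) k) (β₀ : Fin m →₀ ℕ)
    (hgood : ∀ α ∈ f.support, α ≠ β₀ → (∃ γ ∈ f.support, γ ≤ α ∧ γ ≠ α) ∨
      ∃ i : Fin m, ((α i : ℕ) : k) ≠ 0 ∧ ∀ β ∈ f.support, β ≠ α → ((β i : ℕ) : k) = 0 ∨ ∃ γ ∈ f.support, γ ≤ β ∧ γ ≠ β)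
    (F : Finset (Fin m →₀ ℕ)) (hFsub : ∀ β ∈ F, β ∈ f.support) (hFne : F.Nonempty) (hFmin : ∀ β ∈ F, ¬ ∃ γ ∈ f.support, γ ≤ β ∧ γ ≠ β)
    (q : Fin m → k) (hq : ∀ i, q i ≠ 0)
    (h0 : MvPolynomial.eval q (∑ α ∈ F, monomial α (coeff α f)) = 0)
    (hJ : ∀ i : Fin m, MvPolynomial.eval q (pderiv i (∑ α ∈ F, monomial α (coeff α f))) = 0) : False := by
  classical
  by_cases hex : ∃ α ∈ F, α ≠ β₀
  · obtain ⟨α, hαF, hαne⟩ := hex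
    rcases hgood α (hFsub α hαF) hαne with hdom | ⟨i, hαi, hβi⟩
    · exact hFmin α hαF hdom
    · have hJi := hJ i
      rw [map_sum, map_sum, Finset.sum_eq_single α (fun β hβ hβα => by
          rcases hβi β (hFsub β hβ) hβα with hz | hdom
          · rw [pderiv_monomial, hz, mul_zero, monomial_zero, map_zero]
          · exact absurd hdom (hFmin β hβ)) (fun h => (h hαF).elim),
        pderiv_monomial] at hJi
      exact eval_monomial_ne_zero q hq _ _ (mul_ne_zero (MvPolynomial.mem_support_iff.mp (hFsub α hαF)) hαi) hJi
  · push Not at hex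
    obtain ⟨α₁, hα₁F⟩ := hFne
    have hβ₀F : β₀ ∈ F := hex α₁ hα₁F ▸ hα₁F
    have hFeq : F = {β₀} := Finset.eq_singleton_iff_unique_mem.mpr ⟨hβ₀F, hex⟩
    rw [hFeq, Finset.sum_singleton] at h0
    exact eval_monomial_ne_zero q hq _ _ (MvPolynomial.mem_support_iff.mp (hFsub β₀ hβ₀F)) h0

/-- ★ **THE «GOOD SUPPORT» CRITERION, VERSION 2.** `f ≠ 0`; every exponent `α ∈ supp f` other than `β₀` is EITHER dominated by another support point (then it lies on no compact
face) OR good in the relaxed sense (a variable with exponent `≢ 0 (mod p)` in `α` whose exponent in every other NON-dominated monomial is `≡ 0 (mod p)`). Then `f` is weakly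
non-degenerate along every positive weight. [OURS · elementary; cite: BoubakriGreuelMarkwig2010, §3 (p. 10)] -/
theorem weaklyNondegenerate_of_good_support' (f : MvPolynomial (Fin m) k) (hf : f ≠ 0) (β₀ : Fin m →₀ ℕ)
    (hgood : ∀ α ∈ f.support, α ≠ β₀ → (∃ γ ∈ f.support, γ ≤ α ∧ γ ≠ α) ∨
      ∃ i : Fin m, ((α i : ℕ) : k) ≠ 0 ∧ ∀ β ∈ f.support, β ≠ α → ((β i : ℕ) : k) = 0 ∨ ∃ γ ∈ f.support, γ ≤ β ∧ γ ≠ β) :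
    ∀ w : Fin m → ℝ, (∀ i, 0 < w i) → IsWeaklyNondegenerateAlong w (f : MvPowerSeries (Fin m) k) := by
  classical
  intro w hw q hq hT
  unfold IsTjurinaZero IsJacobianZero at hT
  rw [initialForm_coe_real f w] at hT
  simp only [pderiv_coe, evalAt_coe] at hT
  obtain ⟨α₁, hα₁, hmin⟩ := Finset.exists_min_image f.support (fun α => wdeg w α) (MvPolynomial.support_nonempty.mpr hf)
  exact not_tjurinaZero_face' f β₀ hgood _ (fun β hβ => (Finset.mem_filter.mp hβ).1) ⟨α₁, Finset.mem_filter.mpr ⟨hα₁, hmin⟩⟩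
    (fun β hβ => not_dominated_of_mem_face f w hw β (Finset.mem_filter.mp hβ).2) q hq hT.1 hT.2

end Summit.ResolutionOfSingularities.ResolutionOfSingularities.Theorems.FInjectiveMacaulayfication.CensusBedsWeaklyNondegenerate

end
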